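import Summits.BirchSwinnertonDyer.BirchSwinnertonDyer.Theorems.ManinLocalTwoThreeUFamilyConductorAtTwo
import Summits.BirchSwinnertonDyer.Rank1Residual.ManinAdditive.CuspidalKummerUFamilyCurve
import Literature.NumberTheory.EllipticCurves.QuadraticTwistTateFormTwoProofs
import Literature.NumberTheory.DiophantineGeometry.MinimalDiscriminantSmulProofs
import HarnessLib

/-!
# The local portrait of the totally-blind family `y² = (x + u)(x² + 4)` at `2`: Kodaira IV* (`u ≡ 1 (4)`) / I₀* (`u ≡ 3 (4)`),
# `ord₂ Δ_min = 8`, `f₂ = 2` / `4` — Tate's algorithm over `ℤ₂` BY NAME over `IsUFamilyCurve`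
# (route `ManinLocalTwoThree`, crux C2 `ManinOddAtFour` stmt-BirchSwinnertonDyer-22967; cell bsd-f2-manin, an g31/g32 MEMO-an §74–75,
# typer leaf `…/ManinAdditive/CuspidalKummerUFamilyCurve.lean`; p3 gen 12)

Companion of `…UFamilyConductorAtTwo.lean` / `…UFamilyConductorLaw.lean` (S-an-64).  an's census (MEMO-an §75.11,
blind_census.out 86a231102f868176) reads the Kodaira symbols of the totally-blind optimal classes off Cremona's table: IV* at
`4(u²+4)′` (`u ≡ 1 (4)`, 55 classes `≤ 5·10⁵`), I₀* at `16(u²+4)′` (`u ≡ 3 (4)`, 31 classes).  This file makes both rows theorems for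
EVERY member of the family (`IsUFamilyCurve W u`, no optimality, no bound):

* §1 `uFamily_exitModel_IstarZero` (`u = 4k + 3`: `(1, 0, 1, 2) • [0, u, 0, 4, 4u] = [2, 4k+2, 4, 0, 16k+8]` is a Step-6 exit with
  separable cubic `T³ + T² + 1` over `𝔽₂`: type **I₀***), `addVal_Δ_uFamily_exitModel_three` (`ord₂ Δ = 8`); the IV* exit for `u = 4k + 1`
  is `uFamily_exitModel_IVstar` of the sibling.
* §2 `kodairaSymbolAt_two_of_exitModel`, `ordMinimalDiscriminant_two_of_exitModel`: the Kodaira symbol and `ord₂ Δ_min` of `W/ℚ` read on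
  an explicit `ℤ₂` exit model (siblings of `conductorExponent_two_of_exitModel`).
* §3 `exists_exitModel_of_isUFamilyCurve` (undo the translation; base-change bookkeeping), **`kodairaSymbolAt_two_of_uFamily_one`**
  (`u ≡ 1 (4)`: Kodaira IV*, `ord₂ Δ_min = 8`), **`kodairaSymbolAt_two_of_uFamily_three`** (`u ≡ 3 (4)`: Kodaira I₀*, `ord₂ Δ_min = 8`,
  `f₂ = 4`, `v₂(N) = 4` — a DIRECT proof of the exponent that S-an-64 clause 2 obtained through p2's S-an-58 on the twist).

HONEST FRAMING: elementary local bookkeeping for the cell's census rows (an E-an-146 / S-an-64, desc's IV*/I₀* strata); nothing about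
BSD or Manin's conjecture is proved; C2 OPEN.
[cite: SilvermanATAEC1994, IV.9.4 Steps 1–8, IV.11.1 and Table 4.1 (PDF pp. 344–346, 361, 365)]
[cite: BarriosEtAl2025, Thm. 5.1 (arXiv:2501.03209 p. 16), row IV* → I₀*]
-/

set_option autoImplicit false
-- lint-debt: the directory name repeats the summit name (sibling precedent `ManinLocalTwoThreeUFamilyConductorAtTwo.lean`)
set_option linter.dupNamespace false

noncomputable section

open scoped Classical
open Polynomial IsLocalRing WeierstrassCurve
open IsDiscreteValuationRing hiding maximalIdeal
open Literature.NumberTheory.DiophantineGeometry Literature.NumberTheory.DiophantineGeometry.TateAlgorithm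
open Summit.BirchSwinnertonDyer.Rank1Residual.ManinAdditive

namespace Summit.BirchSwinnertonDyer.BirchSwinnertonDyer.Theorems.ManinLocalTwoThree

/-! ## §1 The exit model for `u ≡ 3 (mod 4)`: type I₀* -/

/-- **The `u`-family exit model is of type I₀* for `u = 4k + 3`.**  Tate's algorithm returns `I₀*` on
`T′ = (1, 0, 1, 2) • [0, 4k + 3, 0, 4, 4(4k + 3)] = [2, 4k + 2, 4, 0, 16k + 8]` (Step 6: `2 ∣ a₁, a₂`, `4 ∣ a₃, a₄`, `8 ∣ a₆`; the cubic
`T³ + ε̄(2k+1)‾ T² + ε̄³(2k+1)‾` has discriminant `−31 ε̄⁶(2k+1)‾⁴ ≠ 0` over `𝔽₂`, `2 = ϖε`).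
[cite: SilvermanATAEC1994, IV.9.4 Step 6 (PDF pp. 344–346)] -/
theorem uFamily_exitModel_IstarZero (k : ℤ_[2]) :
    ((⟨1, 0, 1, 2⟩ : VariableChange ℤ_[2]) •
        (⟨0, 4 * k + 3, 0, 4, 4 * (4 * k + 3)⟩ : WeierstrassCurve ℤ_[2])).kodairaSymbolOfMinimal = .Istar 0 := by
  obtain ⟨ε, hε, hpε⟩ := Literature.NumberTheory.EllipticCurves.TwistGoodTwo.exists_isUnit_two_eq_uniformizer_mul_padicInt
  set ϖ : ℤ_[2] := uniformizer ℤ_[2] with hϖ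
  set T' : WeierstrassCurve ℤ_[2] := (⟨1, 0, 1, 2⟩ : VariableChange ℤ_[2]) •
    (⟨0, 4 * k + 3, 0, 4, 4 * (4 * k + 3)⟩ : WeierstrassCurve ℤ_[2]) with hT'
  have hodd : IsUnit (2 * k + 1 : ℤ_[2]) := by
    rw [show (2 * k + 1 : ℤ_[2]) = 1 + 2 * k by ring]; exact isUnit_one_add_two_mul_padicInt _
  have e1 : T'.a₁ = ϖ * ε := by
    rw [hT', variableChange_a₁]; simp; linear_combination hpε
  have e2 : T'.a₂ = ϖ * (ε * (2 * k + 1)) := by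
    rw [hT', variableChange_a₂]; simp; linear_combination (2 * k + 1) * hpε
  have e3 : T'.a₃ = ϖ ^ 2 * ε ^ 2 := by
    rw [hT', variableChange_a₃]; simp; linear_combination (ϖ * ε + 2) * hpε
  have e4 : T'.a₄ = ϖ ^ 2 * 0 := by
    rw [hT', variableChange_a₄]; simp; ring
  have e6 : T'.a₆ = ϖ ^ 3 * (ε ^ 3 * (2 * k + 1)) := by
    rw [hT', variableChange_a₆]; simp
    linear_combination (2 * k + 1) * (ϖ ^ 2 * ε ^ 2 + 2 * ϖ * ε + 4) * hpε
  refine kodairaSymbolOfMinimal_eq_Istar_zero_of_step6 ?_ ?_ ?_ ?_ ?_ ?_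
  · rw [e1]; exact dvd_mul_right _ _
  · rw [e2]; exact dvd_mul_right _ _
  · rw [e3]; exact dvd_mul_right _ _
  · rw [e4]; exact dvd_mul_right _ _
  · rw [e6]; exact dvd_mul_right _ _
  · rw [cubicStep6, e2, e4, e6, ← pow_one ϖ, redCoeff_uniformizer_pow_mul, pow_one, redCoeff_uniformizer_pow_mul,
      redCoeff_uniformizer_pow_mul, distinctRootCount_cubic_eq_three_iff]
    have h4 : (4 : IsLocalRing.ResidueField ℤ_[2]) = 0 := by
      rw [show (4 : IsLocalRing.ResidueField ℤ_[2]) = 2 * 2 by norm_num, two_eq_zero_residueField_padicInt, mul_zero]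
    have h27 : (27 : IsLocalRing.ResidueField ℤ_[2]) = 1 := by
      rw [show (27 : IsLocalRing.ResidueField ℤ_[2]) = 2 * 13 + 1 by norm_num, two_eq_zero_residueField_padicInt,
        zero_mul, zero_add]
    set P := IsLocalRing.residue ℤ_[2] (ε * (2 * k + 1))
    set Rr := IsLocalRing.residue ℤ_[2] (ε ^ 3 * (2 * k + 1))
    have hP : P ≠ 0 := (IsLocalRing.residue_ne_zero_iff_isUnit _).mpr (hε.mul hodd)
    have hR : Rr ≠ 0 := (IsLocalRing.residue_ne_zero_iff_isUnit _).mpr ((hε.pow 3).mul hodd)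
    rw [map_zero]
    have key : P ^ 2 * 0 ^ 2 - 4 * 0 ^ 3 - 4 * P ^ 3 * Rr - 27 * Rr ^ 2 + 18 * P * 0 * Rr = -(Rr ^ 2) := by
      rw [h4, h27]; ring
    rw [key, neg_ne_zero]
    exact pow_ne_zero 2 hR

/-- `ord₂ Δ = 8` on the `u ≡ 3 (mod 4)` exit model (`(4k+3)² + 4 = 1 + 2(8k² + 12k + 6)` is a unit). -/
theorem addVal_Δ_uFamily_exitModel_three (k : ℤ_[2]) :
    (addVal ℤ_[2] ((⟨1, 0, 1, 2⟩ : VariableChange ℤ_[2]) •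
        (⟨0, 4 * k + 3, 0, 4, 4 * (4 * k + 3)⟩ : WeierstrassCurve ℤ_[2])).Δ).toNat = 8 := by
  have hirr : Irreducible (2 : ℤ_[2]) := by exact_mod_cast PadicInt.irreducible_p (p := 2)
  rw [addVal_Δ_smul_toNat]
  have hu : IsUnit ((4 * k + 3) ^ 2 + 4 : ℤ_[2]) := by
    rw [show ((4 * k + 3) ^ 2 + 4 : ℤ_[2]) = 1 + 2 * (8 * k ^ 2 + 12 * k + 6) by ring]
    exact isUnit_one_add_two_mul_padicInt _
  refine addVal_toNat_eq_of_eq hirr (c := 1) (u := -(((4 * k + 3) ^ 2 + 4) ^ 2)) (n := 8) isUnit_one (hu.pow 2).neg ?_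
  simp only [WeierstrassCurve.Δ, WeierstrassCurve.b₂, WeierstrassCurve.b₄, WeierstrassCurve.b₆, WeierstrassCurve.b₈]
  ring

/-! ## §2 Kodaira symbol and `ord Δ_min` read on an explicit exit model over `ℤ₂` -/

/-- **The Kodaira symbol at `2` read on an explicit exit model.** [cite: SilvermanATAEC1994, IV.9.4] -/
theorem kodairaSymbolAt_two_of_exitModel (W : WeierstrassCurve ℚ) [W.IsElliptic]
    (T' : WeierstrassCurve ℤ_[2]) (Cfin : VariableChange ℚ_[2])
    (h : T'.map (algebraMap ℤ_[2] ℚ_[2]) = Cfin • W.baseChange ℚ_[2])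
    (hne : T'.kodairaSymbolOfMinimal ≠ .I 0) :
    W.kodairaSymbolAt ((Rat.HeightOneSpectrum.primesEquiv (R := ℤ)).symm ⟨2, Nat.prime_two⟩) = T'.kodairaSymbolOfMinimal := by
  haveI : Fact (Nat.Prime 2) := ⟨Nat.prime_two⟩
  haveI : Finite (ResidueField ℤ_[2]) := Finite.of_equiv _ (PadicInt.residueField (p := 2)).toEquiv.symm
  set v : IsDedekindDomain.HeightOneSpectrum ℤ := (Rat.HeightOneSpectrum.primesEquiv (R := ℤ)).symm ⟨2, Nat.prime_two⟩ with hvdef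
  have e : Rat.HeightOneSpectrum.primesEquiv (R := ℤ) v = ⟨2, Nat.prime_two⟩ := Equiv.apply_symm_apply _ _
  set X : WeierstrassCurve ℚ_[2] := W.baseChange ℚ_[2] with hX
  haveI hmin : (T'.baseChange ℚ_[2]).IsMinimal ℤ_[2] :=
    isMinimal_baseChange_of_kodairaSymbolOfMinimal_ne_I_zero (K := ℚ_[2]) T' hne
  have hTb : T'.baseChange ℚ_[2] = Cfin • X := h
  have hΔ : (T'.baseChange ℚ_[2]).Δ ≠ 0 := by
    rw [hTb]; exact (Cfin • X).isUnit_Δ.ne_zero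
  have hkod : X.kodairaSymbol ℤ_[2] = T'.kodairaSymbolOfMinimal := by
    rw [kodairaSymbol_eq_kodairaSymbolOfMinimal_of_isMinimal (R := ℤ_[2]) X (T'.baseChange ℚ_[2]) Cfin hTb hΔ,
      WeierstrassCurve.integralModel_baseChange_eq]
  have hKp := WeierstrassCurve.kodairaSymbolAt_eq_padic (R := ℤ) v W
  rw [e] at hKp
  change W.kodairaSymbolAt v = (W.baseChange ℚ_[2]).kodairaSymbol ℤ_[2] at hKp
  rw [hKp, ← hX, hkod]

/-- **`ord₂ Δ_min` read on an explicit exit model.** [cite: SilvermanATAEC1994, IV.9.4] [cite: SilvermanAEC2009, VII.1 Prop. 1.3(b)] -/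
theorem ordMinimalDiscriminant_two_of_exitModel (W : WeierstrassCurve ℚ) [W.IsElliptic]
    (T' : WeierstrassCurve ℤ_[2]) (Cfin : VariableChange ℚ_[2])
    (h : T'.map (algebraMap ℤ_[2] ℚ_[2]) = Cfin • W.baseChange ℚ_[2])
    (hne : T'.kodairaSymbolOfMinimal ≠ .I 0) :
    W.ordMinimalDiscriminant ((Rat.HeightOneSpectrum.primesEquiv (R := ℤ)).symm ⟨2, Nat.prime_two⟩) =
      (addVal ℤ_[2] T'.Δ).toNat := by
  haveI : Fact (Nat.Prime 2) := ⟨Nat.prime_two⟩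
  haveI : Finite (ResidueField ℤ_[2]) := Finite.of_equiv _ (PadicInt.residueField (p := 2)).toEquiv.symm
  set v : IsDedekindDomain.HeightOneSpectrum ℤ := (Rat.HeightOneSpectrum.primesEquiv (R := ℤ)).symm ⟨2, Nat.prime_two⟩ with hvdef
  have e : Rat.HeightOneSpectrum.primesEquiv (R := ℤ) v = ⟨2, Nat.prime_two⟩ := Equiv.apply_symm_apply _ _
  set X : WeierstrassCurve ℚ_[2] := W.baseChange ℚ_[2] with hX
  haveI hmin : (T'.baseChange ℚ_[2]).IsMinimal ℤ_[2] :=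
    isMinimal_baseChange_of_kodairaSymbolOfMinimal_ne_I_zero (K := ℚ_[2]) T' hne
  have hTb : T'.baseChange ℚ_[2] = Cfin • X := h
  have hΔ : (T'.baseChange ℚ_[2]).Δ ≠ 0 := by
    rw [hTb]; exact (Cfin • X).isUnit_Δ.ne_zero
  have hord : (addVal ℤ_[2] ((X.minimal ℤ_[2]).integralModel ℤ_[2]).Δ).toNat = (addVal ℤ_[2] T'.Δ).toNat := by
    rw [addVal_Δ_minimal_toNat_eq_of_isMinimal (R := ℤ_[2]) X (T'.baseChange ℚ_[2]) Cfin hTb hΔ,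
      WeierstrassCurve.integralModel_baseChange_eq]
  have hOp := WeierstrassCurve.ordMinimalDiscriminant_eq_padic (R := ℤ) v W
  rw [e] at hOp
  change W.ordMinimalDiscriminant v = (addVal ℤ_[2] (((W.baseChange ℚ_[2]).minimal ℤ_[2]).integralModel ℤ_[2]).Δ).toNat at hOp
  rw [hOp, ← hX, hord]

/-! ## §3 The local portrait of the family at `2` -/

/-- From a `u`-family curve to the `ℤ₂` exit model: some `ℚ`-isomorph of `W` is `E_u = [0, u, 0, 4, 4u]`, and the exit model
`(1, 0, 1, 2) • E_u` over `ℤ₂` is a `ℚ₂`-isomorph of `W ⊗ ℚ₂`. -/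
theorem exists_exitModel_of_isUFamilyCurve (W : WeierstrassCurve ℚ) [W.IsElliptic] (u : ℤ) (hW : IsUFamilyCurve W u) :
    ∃ (C' : VariableChange ℚ) (Cfin : VariableChange ℚ_[2]),
      C' • W = ⟨0, (u : ℚ), 0, 4, 4 * (u : ℚ)⟩ ∧
      ((⟨1, 0, 1, 2⟩ : VariableChange ℤ_[2]) • (⟨0, (u : ℤ_[2]), 0, 4, 4 * (u : ℤ_[2])⟩ : WeierstrassCurve ℤ_[2])).map
          (algebraMap ℤ_[2] ℚ_[2]) = Cfin • (C' • W).baseChange ℚ_[2] := by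
  haveI : Fact (Nat.Prime 2) := ⟨Nat.prime_two⟩
  obtain ⟨C, s, h₁, h₃, h₂, h₄, h₆⟩ := hW
  set C' : VariableChange ℚ := (⟨1, -(s : ℚ), 0, 0⟩ : VariableChange ℚ) * C with hC'
  have hV : C' • W = ⟨0, (u : ℚ), 0, 4, 4 * (u : ℚ)⟩ := by
    rw [hC', mul_smul]
    ext
    · rw [variableChange_a₁, h₁]; simp
    · rw [variableChange_a₂, h₁, h₂]; push_cast; simp
    · rw [variableChange_a₃, h₁, h₃]; simp
    · rw [variableChange_a₄, h₁, h₂, h₃, h₄]; push_cast; simp; ring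
    · rw [variableChange_a₆, h₁, h₂, h₃, h₄, h₆]; push_cast; simp; ring
  set E : WeierstrassCurve ℤ_[2] := ⟨0, (u : ℤ_[2]), 0, 4, 4 * (u : ℤ_[2])⟩ with hE
  have hEV : E.map (algebraMap ℤ_[2] ℚ_[2]) = (C' • W).baseChange ℚ_[2] := by
    have c4 : ((4 : ℤ_[2]) : ℚ_[2]) = 4 := map_ofNat PadicInt.Coe.ringHom 4
    rw [hV, hE]
    ext <;> simp [WeierstrassCurve.map, c4]
  refine ⟨C', (⟨1, 0, 1, 2⟩ : VariableChange ℤ_[2]).map (algebraMap ℤ_[2] ℚ_[2]), hV, ?_⟩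
  rw [← hEV]
  exact (WeierstrassCurve.map_variableChange _ _ _).symm

/-- **The totally-blind family at `2`, `u ≡ 1 (mod 4)`: Kodaira type IV* and `ord₂ Δ_min = 8`** (hence `f₂ = 2`,
`padicValNat_two_conductorNorm_of_uFamily`).  Census (an g32): all 55 optimal blind classes with `4 ∥ N ≤ 5·10⁵`.
[cite: SilvermanATAEC1994, IV.9.4 Steps 6–8 and Table 4.1] -/
theorem kodairaSymbolAt_two_of_uFamily_one (W : WeierstrassCurve ℚ) [W.IsElliptic] (u : ℤ) (hu : u % 4 = 1)
    (hW : IsUFamilyCurve W u) :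
    W.kodairaSymbolAt ((Rat.HeightOneSpectrum.primesEquiv (R := ℤ)).symm ⟨2, Nat.prime_two⟩) = .IVstar ∧
    W.ordMinimalDiscriminant ((Rat.HeightOneSpectrum.primesEquiv (R := ℤ)).symm ⟨2, Nat.prime_two⟩) = 8 := by
  haveI : Fact (Nat.Prime 2) := ⟨Nat.prime_two⟩
  set v : IsDedekindDomain.HeightOneSpectrum ℤ := (Rat.HeightOneSpectrum.primesEquiv (R := ℤ)).symm ⟨2, Nat.prime_two⟩
  obtain ⟨C', Cfin, hV, h⟩ := exists_exitModel_of_isUFamilyCurve W u hW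
  set k : ℤ := u / 4 with hk
  have huk : u = 4 * k + 1 := by omega
  have hcast : (u : ℤ_[2]) = 4 * (k : ℤ_[2]) + 1 := by rw [huk]; push_cast; ring
  rw [hcast] at h
  have hexit := uFamily_exitModel_IVstar (k : ℤ_[2])
  have hne : ((⟨1, 0, 1, 2⟩ : VariableChange ℤ_[2]) •
      (⟨0, 4 * (k : ℤ_[2]) + 1, 0, 4, 4 * (4 * (k : ℤ_[2]) + 1)⟩ : WeierstrassCurve ℤ_[2])).kodairaSymbolOfMinimal ≠ .I 0 := by
    rw [hexit]; decide
  refine ⟨?_, ?_⟩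
  · rw [← WeierstrassCurve.kodairaSymbolAt_smul' v W C', kodairaSymbolAt_two_of_exitModel (C' • W) _ Cfin h hne, hexit]
  · rw [← WeierstrassCurve.ordMinimalDiscriminant_smul_holds v W C', ordMinimalDiscriminant_two_of_exitModel (C' • W) _ Cfin h hne,
      addVal_Δ_uFamily_exitModel]

/-- **The totally-blind family at `2`, `u ≡ 3 (mod 4)`: Kodaira type I₀*, `ord₂ Δ_min = 8`, `f₂ = 8 + 1 − 5 = 4`, `v₂(N) = 4`.**
Census (an g32): all 31 optimal blind classes with `16 ∣ N ≤ 5·10⁵` (the `χ₋₄`-partners at `16(u²+4)′` of the IV* members).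
[cite: SilvermanATAEC1994, IV.9.4 Step 6, IV.11.1 and Table 4.1] [cite: BarriosEtAl2025, Thm. 5.1 (arXiv:2501.03209 p. 16), row IV* → I₀*] -/
theorem kodairaSymbolAt_two_of_uFamily_three (W : WeierstrassCurve ℚ) [W.IsElliptic] (u : ℤ) (hu : u % 4 = 3)
    (hW : IsUFamilyCurve W u) :
    W.kodairaSymbolAt ((Rat.HeightOneSpectrum.primesEquiv (R := ℤ)).symm ⟨2, Nat.prime_two⟩) = .Istar 0 ∧
    W.ordMinimalDiscriminant ((Rat.HeightOneSpectrum.primesEquiv (R := ℤ)).symm ⟨2, Nat.prime_two⟩) = 8 ∧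
    W.conductorExponent ((Rat.HeightOneSpectrum.primesEquiv (R := ℤ)).symm ⟨2, Nat.prime_two⟩) = 4 ∧
    padicValNat 2 (W.conductorNorm ℤ) = 4 := by
  haveI : Fact (Nat.Prime 2) := ⟨Nat.prime_two⟩
  set v : IsDedekindDomain.HeightOneSpectrum ℤ := (Rat.HeightOneSpectrum.primesEquiv (R := ℤ)).symm ⟨2, Nat.prime_two⟩
    with hvdef
  have hv : Rat.HeightOneSpectrum.natGenerator v = 2 :=
    congrArg Subtype.val ((Rat.HeightOneSpectrum.primesEquiv (R := ℤ)).apply_symm_apply ⟨2, Nat.prime_two⟩)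
  obtain ⟨C', Cfin, hV, h⟩ := exists_exitModel_of_isUFamilyCurve W u hW
  set k : ℤ := u / 4 with hk
  have huk : u = 4 * k + 3 := by omega
  have hcast : (u : ℤ_[2]) = 4 * (k : ℤ_[2]) + 3 := by rw [huk]; push_cast; ring
  rw [hcast] at h
  have hexit := uFamily_exitModel_IstarZero (k : ℤ_[2])
  have hne : ((⟨1, 0, 1, 2⟩ : VariableChange ℤ_[2]) •
      (⟨0, 4 * (k : ℤ_[2]) + 3, 0, 4, 4 * (4 * (k : ℤ_[2]) + 3)⟩ : WeierstrassCurve ℤ_[2])).kodairaSymbolOfMinimal ≠ .I 0 := by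
    rw [hexit]; decide
  have hf : W.conductorExponent v = 4 := by
    rw [← WeierstrassCurve.conductorExponent_smul' v W C', conductorExponent_two_of_exitModel (C' • W) _ Cfin h hne, hexit,
      addVal_Δ_uFamily_exitModel_three]
    rfl
  refine ⟨?_, ?_, hf, ?_⟩
  · rw [← WeierstrassCurve.kodairaSymbolAt_smul' v W C', kodairaSymbolAt_two_of_exitModel (C' • W) _ Cfin h hne, hexit]
  · rw [← WeierstrassCurve.ordMinimalDiscriminant_smul_holds v W C', ordMinimalDiscriminant_two_of_exitModel (C' • W) _ Cfin h hne,
      addVal_Δ_uFamily_exitModel_three]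
  · have hfac : (W.conductorNorm ℤ).factorization 2 = W.conductorExponent v := by
      rw [← hv]; exact W.factorization_conductorNorm_holds v
    rw [← Nat.factorization_def _ Nat.prime_two, hfac, hf]

end Summit.BirchSwinnertonDyer.BirchSwinnertonDyer.Theorems.ManinLocalTwoThree

end
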